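import Summits.AtomisticToContinuum.HydrodynamicLimit.Theorems.TwoClocksEquilibriumFastWindowLDBirthPreVelLedger
import HarnessLib

/-!
# Telescoping of one-particle velocity functionals along the hard-sphere flow and the
# CONTAMINATION bound of the non-retained increments (helper `ccb5_comp_vel_telescope` of the
# line `birth`, crux `TwoClocks.EquilibriumFastWindowLD`, stmt-AtomisticToContinuum-14440)

Along a hard-sphere trajectory `γ` in a regular geometry the velocity of particle `i` is piecewise
constant and jumps only at the own collisions of `i`; the jump is read off the ORDERED record with
`fst = i` (`HardSphereCollisionRecord.ofConfig`). Hence for EVERY function `f` of one velocity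
(no continuity needed: free flight keeps velocities, so `s ↦ f (v_i(s))` is constant between
collisions) and `a ≤ b`:

* `apply_vel_sub_eq_collisionSum` — `f (v_i(b)) - f (v_i(a)) = Σ_{records in (a,b], fst = i}
  (f v⁺ - f v⁻)` (the weak balance law `IsHardSphereTrajectory.sub_eq_integral_add_collisionalTransfer`
  for the observable `w ↦ f (w i).2`, whose streaming derivative vanishes, plus the record-wise
  identification of the jump, `sum_contactPairs_ite_fst_apply_eq_jump`); the case `f = id` is the
  velocity ledger `vel_sub_vel_eq_collisionSum` of the file `…BirthPreVelLedger`;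
* `leftLim_apply_vel_eq_add_collisionSum_Ioo` — predictable form with the open window `(a, t)`;
* `collisionSum_ite_fst_one_sub_smul_eq` — for any weight `ρ` on records, the `(1 - ρ)`-weighted
  own increments are the full telescoped difference minus the `ρ`-weighted ones;
* `norm_collisionSum_nonret_le` — the **contamination bound**: if `ρ ∈ {0, 1}` record-wise (model:
  the retained indicator `ret = ω_fst ω_snd` of the pair-clamped streams), then
  `‖Σ_{fst = i} (1 - ρ) (f v⁺ - f v⁻)‖ ≤ min 1 (Σ_{fst = i} (1 - ρ)) · (‖f v_i(a)‖ + ‖f v_i(b)‖ +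
  Σ_{fst = i} ρ (‖f v⁻‖ + ‖f v⁺‖))` — a particle without non-retained own record contributes
  nothing, a contaminated one at most its two end values and all its retained values. With
  `f = Ψ ∘ ‖·‖`, `Ψ r = (1+r)(1+log(1+r))`, summed over `i`, the right-hand side is the functional
  `Cont` of the run census `stub_runCensus` (D₄ of the line `birth`, contamination form): this is
  the pathwise domination of the non-retained remainder of the corrector identity by `Cont`
  (velocity part; the transport inside runs is the static transport functional);
* `ccb5_comp_vel_telescope` (registered helper) — the flow form on `𝕋³` at `0 < σ < 1/2` for
  `f : V3 → ℝ`, `z ∈ Φ.good`, `a ≤ b`.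

References: Cercignani–Illner–Pulvirenti 1994 §4.2; Gallagher–Saint-Raymond–Texier 2013 §4.1;
Spohn 1991 Part I §3.2 (weak balance laws along trajectories).
-/

noncomputable section

open MeasureTheory Set Filter Function
open scoped ENNReal BigOperators

namespace Summit.AtomisticToContinuum.HydrodynamicLimit.Theorems.ClampedCorrectorBirth

open Literature.Analysis.FluidPDE Literature.MathematicalPhysics.KineticTheory

section Trajectory

variable {d : Type*} [Fintype d] {X : Type*} [TopologicalSpace X] [T2Space X] {n : ℕ}
  {G : Geometry d X} {ε : ℝ} {γ : ℝ → Config n d X}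
  {E : Type*} [NormedAddCommGroup E] [NormedSpace ℝ E]

omit [NormedSpace ℝ E] in
/-- **The record increment of `f ∘ v_i` at a collision time is the jump of `f (v_i)`.** At a
collision time `t` of a hard-sphere trajectory in a regular geometry, for every function `f` of
one velocity, the sum over the ordered contact pairs `p` of
`if p.1 = i then f v_{p.1}⁺ - f v_{p.1}⁻ else 0` is `f (v_i(t)) - f (v_i(t⁻))`: the two records of
the colliding pair `{p, q}` contribute the jumps of `p` and of `q`, a third particle does not jump. -/
theorem sum_contactPairs_ite_fst_apply_eq_jump (h : IsHardSphereTrajectory G ε n γ)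
    (hG : G.IsHardSphereRegular ε) {t : ℝ} (ht : t ∈ collisionTimes G ε γ)
    (f : EuclideanSpace ℝ d → E) (i : Fin n) :
    ∑ p ∈ contactPairs G ε (γ t),
        (if (HardSphereCollisionRecord.ofConfig G ε (γ t) t p.1 p.2).fst = i then
          f (HardSphereCollisionRecord.ofConfig G ε (γ t) t p.1 p.2).postVel.1 -
            f (HardSphereCollisionRecord.ofConfig G ε (γ t) t p.1 p.2).preVel.1 else 0) =
      f (γ t i).2 - f (leftLim γ t i).2 := by
  obtain ⟨⟨p, q⟩, hp⟩ := mem_collisionTimes_iff_contactPairs_nonempty.1 ht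
  obtain ⟨hpq, hc⟩ := mem_contactPairs.1 hp
  have hq : (q, p) ∈ contactPairs G ε (γ t) := (swap_mem_contactPairs_iff hG).2 hp
  have hne : (p, q) ≠ (q, p) := fun hpe => hpq (Prod.mk.inj hpe).1
  have hpre_p : (HardSphereCollisionRecord.ofConfig G ε (γ t) t p q).preVel.1 = (leftLim γ t p).2 :=
    congrArg Prod.fst (h.ofConfig_preVel_eq_leftLim hp)
  have hpre_q : (HardSphereCollisionRecord.ofConfig G ε (γ t) t q p).preVel.1 = (leftLim γ t q).2 :=
    congrArg Prod.fst (h.ofConfig_preVel_eq_leftLim hq)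
  rw [h.contactPairs_eq_pair hG hp, Finset.sum_pair hne]
  simp only [HardSphereCollisionRecord.ofConfig_fst, HardSphereCollisionRecord.ofConfig_postVel,
    hpre_p, hpre_q]
  by_cases hip : p = i
  · subst hip
    rw [if_pos rfl, if_neg (Ne.symm hpq), add_zero]
  by_cases hiq : q = i
  · subst hiq
    rw [if_neg hip, if_pos rfl, zero_add]
  · rw [if_neg hip, if_neg hiq, add_zero,
      h.apply_eq_leftLim_apply_of_ne hpq hc (Ne.symm hip) (Ne.symm hiq), sub_self]

/-- **Telescoping of `f ∘ v_i` along a hard-sphere trajectory.** In a regular geometry, for every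
function `f` of one velocity with values in a complete normed space, every particle `i` and
`a ≤ b`: `f (v_i(b)) - f (v_i(a))` is the collision sum over the records in `(a, b]` with `fst = i`
of `f v⁺ - f v⁻` (free flight keeps velocities, so the weak balance law for `w ↦ f (w i).2` has
no streaming term; its collisional term is identified record by record). -/
theorem apply_vel_sub_eq_collisionSum [CompleteSpace E] (h : IsHardSphereTrajectory G ε n γ)
    (hG : G.IsHardSphereRegular ε) (f : EuclideanSpace ℝ d → E) (i : Fin n) {a b : ℝ}
    (hab : a ≤ b) :
    f (γ b i).2 - f (γ a i).2 =
      collisionSum G ε γ (Ioc a b)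
        (fun c => if c.fst = i then f c.postVel.1 - f c.preVel.1 else 0) := by
  have hF : ∀ (z : Config n d X) (t : ℝ),
      HasDerivAt (fun s => f (freeFlight G s z i).2) (0 : E) t := fun z t => by
    simp only [freeFlight_apply]
    exact hasDerivAt_const t _
  have hbal := (h.sub_eq_integral_add_collisionalTransfer (F := fun w : Config n d X => f (w i).2)
    (F' := fun _ : Config n d X => (0 : E)) hG.continuous_translate_left hF
    (fun _ => continuous_const) hab).2
  rw [intervalIntegral.integral_zero, zero_add] at hbal
  rw [hbal, collisionalTransfer, collisionSum_eq_collisionPairSum, collisionPairSum]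
  refine finsum_mem_congr rfl fun t ht => ?_
  rw [sum_contactPairs_ite_fst_apply_eq_jump h hG ht.1 f i, collisionJump]

/-- **Predictable telescoping.** For `a < t` the value of `f` at the LEFT-limit velocity of
particle `i` at `t` is `f (v_i(a))` plus the collision sum of the own increments of `f ∘ v_i` over
the OPEN window `(a, t)` (the collision at `t` itself, if any, excluded). -/
theorem leftLim_apply_vel_eq_add_collisionSum_Ioo [CompleteSpace E]
    (h : IsHardSphereTrajectory G ε n γ) (hG : G.IsHardSphereRegular ε)
    (f : EuclideanSpace ℝ d → E) (i : Fin n) {a t : ℝ} (hat : a < t) :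
    f (leftLim γ t i).2 = f (γ a i).2 +
      collisionSum G ε γ (Ioo a t)
        (fun c => if c.fst = i then f c.postVel.1 - f c.preVel.1 else 0) := by
  have hled := apply_vel_sub_eq_collisionSum h hG f i hat.le
  have hfinO : (collisionTimes G ε γ ∩ Ioo a t).Finite :=
    h.finite_collisionTimes_inter_of_subset_Icc Ioo_subset_Icc_self
  have hfinT : (collisionTimes G ε γ ∩ {t}).Finite := (Set.finite_singleton t).subset inter_subset_right
  have hdisj : Disjoint (Ioo a t) {t} := Set.disjoint_singleton_right.2 fun hm => lt_irrefl t hm.2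
  rw [← Ioo_union_right hat, collisionSum_union hfinO hfinT hdisj] at hled
  have hjump : collisionSum G ε γ {t}
      (fun c => if c.fst = i then f c.postVel.1 - f c.preVel.1 else 0) =
        f (γ t i).2 - f (leftLim γ t i).2 := by
    by_cases ht : t ∈ collisionTimes G ε γ
    · have hset : collisionTimes G ε γ ∩ {t} = {t} := inter_eq_right.2 (singleton_subset_iff.2 ht)
      rw [collisionSum_eq_collisionPairSum, collisionPairSum, hset, finsum_mem_singleton]
      exact sum_contactPairs_ite_fst_apply_eq_jump h hG ht f i
    · have hset : collisionTimes G ε γ ∩ {t} = ∅ :=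
        Set.eq_empty_iff_forall_notMem.2 fun s hs => ht (mem_singleton_iff.1 hs.2 ▸ hs.1)
      rw [collisionSum_eq_collisionPairSum, collisionPairSum, hset, finsum_mem_empty,
        h.leftLim_eq_of_not_mem hG.continuous_translate_left ht, sub_self]
  rw [hjump] at hled
  have e : f (leftLim γ t i).2 =
      f (γ a i).2 + ((f (γ t i).2 - f (γ a i).2) - (f (γ t i).2 - f (leftLim γ t i).2)) := by
    abel
  rw [e, hled]
  abel

/-- **Splitting the own increments by a weight.** For every weight `ρ` on records (model: the
retained indicator `ret = ω_fst ω_snd`), the `(1 - ρ)`-weighted collision sum of the own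
increments of `f ∘ v_i` over `(a, b]` is the telescoped difference `f (v_i(b)) - f (v_i(a))` minus
the `ρ`-weighted one. -/
theorem collisionSum_ite_fst_one_sub_smul_eq [CompleteSpace E] (h : IsHardSphereTrajectory G ε n γ)
    (hG : G.IsHardSphereRegular ε) (f : EuclideanSpace ℝ d → E)
    (ρ : HardSphereCollisionRecord d X n → ℝ) (i : Fin n) {a b : ℝ} (hab : a ≤ b) :
    collisionSum G ε γ (Ioc a b)
        (fun c => if c.fst = i then (1 - ρ c) • (f c.postVel.1 - f c.preVel.1) else 0) =
      (f (γ b i).2 - f (γ a i).2) -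
        collisionSum G ε γ (Ioc a b)
          (fun c => if c.fst = i then ρ c • (f c.postVel.1 - f c.preVel.1) else 0) := by
  have hfin : (collisionTimes G ε γ ∩ Ioc a b).Finite := h.finite_collisionTimes_inter_Ioc a b
  rw [apply_vel_sub_eq_collisionSum h hG f i hab, collisionSum_eq_finset_sum hfin,
    collisionSum_eq_finset_sum hfin, collisionSum_eq_finset_sum hfin, ← Finset.sum_sub_distrib]
  refine Finset.sum_congr rfl fun t _ => ?_
  rw [← Finset.sum_sub_distrib]
  refine Finset.sum_congr rfl fun p _ => ?_
  split_ifs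
  · rw [sub_smul, one_smul]
  · rw [sub_zero]

omit [TopologicalSpace X] [T2Space X] in
/-- A `{0, 1}`-valued functional of the record either vanishes at every record of the window or
has collision sum at least `1` (finitely many collision times in the window). -/
theorem collisionSum_eq_zero_or_one_le {S : Set ℝ} (hfin : (collisionTimes G ε γ ∩ S).Finite)
    {F : HardSphereCollisionRecord d X n → ℝ} (hF : ∀ c, F c = 0 ∨ F c = 1) :
    (∀ t ∈ collisionTimes G ε γ ∩ S, ∀ p ∈ contactPairs G ε (γ t),
        F (HardSphereCollisionRecord.ofConfig G ε (γ t) t p.1 p.2) = 0) ∨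
      1 ≤ collisionSum G ε γ S F := by
  classical
  have hF0 : ∀ c, 0 ≤ F c := fun c => by
    rcases hF c with h0 | h1
    · rw [h0]
    · rw [h1]; exact zero_le_one
  by_cases hall : ∀ t ∈ collisionTimes G ε γ ∩ S, ∀ p ∈ contactPairs G ε (γ t),
      F (HardSphereCollisionRecord.ofConfig G ε (γ t) t p.1 p.2) = 0
  · exact Or.inl hall
  right
  simp only [not_forall] at hall
  obtain ⟨t, ht, p, hp, hne⟩ := hall
  have hone : F (HardSphereCollisionRecord.ofConfig G ε (γ t) t p.1 p.2) = 1 :=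
    (hF _).resolve_left hne
  have ht' : t ∈ hfin.toFinset := (Set.Finite.mem_toFinset hfin).2 ht
  rw [collisionSum_eq_finset_sum hfin]
  calc (1 : ℝ) = F (HardSphereCollisionRecord.ofConfig G ε (γ t) t p.1 p.2) := hone.symm
    _ ≤ ∑ q ∈ contactPairs G ε (γ t), F (HardSphereCollisionRecord.ofConfig G ε (γ t) t q.1 q.2) :=
      Finset.single_le_sum (f := fun q : Fin n × Fin n =>
        F (HardSphereCollisionRecord.ofConfig G ε (γ t) t q.1 q.2)) (fun q _ => hF0 _) hp
    _ ≤ ∑ s ∈ hfin.toFinset, ∑ q ∈ contactPairs G ε (γ s),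
          F (HardSphereCollisionRecord.ofConfig G ε (γ s) s q.1 q.2) :=
      Finset.single_le_sum (f := fun s => ∑ q ∈ contactPairs G ε (γ s),
        F (HardSphereCollisionRecord.ofConfig G ε (γ s) s q.1 q.2))
        (fun s _ => Finset.sum_nonneg fun q _ => hF0 _) ht'

/-- **The contamination bound.** Along a hard-sphere trajectory in a regular geometry, for a
`{0, 1}`-valued weight `ρ` on records (the retained indicator), every `f`, particle `i` and
`a ≤ b`: the norm of the sum of the NON-retained own increments `Σ_{fst = i} (1 - ρ)(f v⁺ - f v⁻)`
over `(a, b]` is at most `min 1 (number of non-retained own records) ·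
(‖f v_i(a)‖ + ‖f v_i(b)‖ + Σ_{fst = i} ρ (‖f v⁻‖ + ‖f v⁺‖))` — zero if the particle has no
non-retained own record in the window, else (telescoping, `collisionSum_ite_fst_one_sub_smul_eq`)
its two end values plus all its retained values. This is the per-particle, velocity-part
domination of the non-retained remainder by the contamination functional of the run census. -/
theorem norm_collisionSum_nonret_le [CompleteSpace E] (h : IsHardSphereTrajectory G ε n γ)
    (hG : G.IsHardSphereRegular ε) (f : EuclideanSpace ℝ d → E)
    {ρ : HardSphereCollisionRecord d X n → ℝ} (hρ : ∀ c, ρ c = 0 ∨ ρ c = 1) (i : Fin n) {a b : ℝ}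
    (hab : a ≤ b) :
    ‖collisionSum G ε γ (Ioc a b)
        (fun c => if c.fst = i then (1 - ρ c) • (f c.postVel.1 - f c.preVel.1) else 0)‖ ≤
      min 1 (collisionSum G ε γ (Ioc a b) (fun c => if c.fst = i then 1 - ρ c else (0 : ℝ))) *
        (‖f (γ a i).2‖ + ‖f (γ b i).2‖ +
          collisionSum G ε γ (Ioc a b)
            (fun c => if c.fst = i then ρ c * (‖f c.preVel.1‖ + ‖f c.postVel.1‖) else 0)) := by
  classical
  have hfin : (collisionTimes G ε γ ∩ Ioc a b).Finite := h.finite_collisionTimes_inter_Ioc a b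
  have hρ01 : ∀ c, 0 ≤ 1 - ρ c := fun c => by
    rcases hρ c with h0 | h1
    · rw [h0, sub_zero]; exact zero_le_one
    · rw [h1, sub_self]
  have hρnn : ∀ c, 0 ≤ ρ c := fun c => by
    rcases hρ c with h0 | h1
    · rw [h0]
    · rw [h1]; exact zero_le_one
  -- the indicator of the non-retained own records is `{0, 1}`-valued
  have hF : ∀ c : HardSphereCollisionRecord d X n,
      (if c.fst = i then 1 - ρ c else (0 : ℝ)) = 0 ∨ (if c.fst = i then 1 - ρ c else (0 : ℝ)) = 1 := by
    intro c
    split_ifs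
    · rcases hρ c with h0 | h1
      · exact Or.inr (by rw [h0, sub_zero])
      · exact Or.inl (by rw [h1, sub_self])
    · exact Or.inl rfl
  -- both factors of the right-hand side are nonnegative
  have hN : 0 ≤ collisionSum G ε γ (Ioc a b) (fun c => if c.fst = i then 1 - ρ c else (0 : ℝ)) := by
    rw [collisionSum_eq_collisionPairSum]
    refine collisionPairSum_nonneg fun t p q => ?_
    split_ifs
    · exact hρ01 _
    · exact le_rfl
  have hR : 0 ≤ ‖f (γ a i).2‖ + ‖f (γ b i).2‖ + collisionSum G ε γ (Ioc a b)
      (fun c => if c.fst = i then ρ c * (‖f c.preVel.1‖ + ‖f c.postVel.1‖) else 0) := by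
    refine add_nonneg (add_nonneg (norm_nonneg _) (norm_nonneg _)) ?_
    rw [collisionSum_eq_collisionPairSum]
    refine collisionPairSum_nonneg fun t p q => ?_
    split_ifs
    · exact mul_nonneg (hρnn _) (add_nonneg (norm_nonneg _) (norm_nonneg _))
    · exact le_rfl
  rcases collisionSum_eq_zero_or_one_le hfin hF with hzero | hge
  · -- no non-retained own record in the window: the left-hand side vanishes
    have hL : collisionSum G ε γ (Ioc a b)
        (fun c => if c.fst = i then (1 - ρ c) • (f c.postVel.1 - f c.preVel.1) else 0) = 0 := by
      rw [collisionSum_eq_finset_sum hfin]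
      refine Finset.sum_eq_zero fun t ht => Finset.sum_eq_zero fun p hp => ?_
      have h0 := hzero t ((Set.Finite.mem_toFinset hfin).1 ht) p hp
      by_cases hfst : (HardSphereCollisionRecord.ofConfig G ε (γ t) t p.1 p.2).fst = i
      · rw [if_pos hfst] at h0 ⊢
        rw [h0, zero_smul]
      · rw [if_neg hfst]
    rw [hL, norm_zero]
    exact mul_nonneg (le_min zero_le_one hN) hR
  · -- at least one non-retained own record: telescope and bound term by term
    rw [min_eq_left hge, one_mul, collisionSum_ite_fst_one_sub_smul_eq h hG f ρ i hab]
    refine (norm_sub_le _ _).trans (add_le_add ?_ ?_)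
    · rw [add_comm]
      exact norm_sub_le _ _
    · refine (norm_collisionSum_le hfin _).trans ?_
      rw [collisionSum_eq_finset_sum hfin, collisionSum_eq_finset_sum hfin]
      refine Finset.sum_le_sum fun t _ => Finset.sum_le_sum fun p _ => ?_
      by_cases hfst : (HardSphereCollisionRecord.ofConfig G ε (γ t) t p.1 p.2).fst = i
      · rw [if_pos hfst, if_pos hfst]
        rcases hρ (HardSphereCollisionRecord.ofConfig G ε (γ t) t p.1 p.2) with h0 | h1
        · rw [h0, zero_smul, norm_zero, zero_mul]
        · rw [h1, one_smul, one_mul, add_comm]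
          exact norm_sub_le _ _
      · rw [if_neg hfst, if_neg hfst, norm_zero]

end Trajectory

/-- **Telescoping of one-particle velocity functionals along the hard-sphere flow on `𝕋³`.**
For reduced diameter `0 < σ < 1/2` (so that the torus geometry is hard-sphere regular at
`hsDiameter σ N ≤ σ < 1/2`), a flow `Φ` of `N + 1` spheres, a GOOD initial datum `z`, EVERY function
`f : V3 → ℝ` of one velocity (no regularity), every particle `i` and all times `a ≤ b`:
`f (v_i(b)) - f (v_i(a))` equals the collision sum over the records of the orbit with times in
`(a, b]` and `fst = i` of `f v⁺ - f v⁻` — the velocity of `i` is constant between its own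
collisions (`IsHardSphereTrajectory.free`) and its jump at an own collision is read off the ordered
record with `fst = i`. This is the function version of the velocity ledger
`vel_sub_vel_eq_collisionSum`; it is the telescoping behind the run census of the line `birth`
(sum of the non-retained own increments = end values minus retained increments, see
`norm_collisionSum_nonret_le`). -/
theorem ccb5_comp_vel_telescope : ∀ (σ : ℝ), 0 < σ → σ < 2⁻¹ → ∀ (N : ℕ)
    (Φ : HardSphereFlow (Torus.geometry (Fin 3)) (hsDiameter σ N) (N + 1))
    (z : Config (N + 1) (Fin 3) T3), z ∈ Φ.good → ∀ (f : V3 → ℝ) (i : Fin (N + 1)) (a b : ℝ),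
    a ≤ b →
    f (Φ.flow b z i).2 - f (Φ.flow a z i).2 =
      Φ.collisionSum (Set.Ioc a b)
        (fun c => if c.fst = i then f c.postVel.1 - f c.preVel.1 else 0) z := by
  intro σ hσ hσ2 N Φ z hz f i a b hab
  have hG : (Torus.geometry (Fin 3)).IsHardSphereRegular (hsDiameter σ N) :=
    Torus.isHardSphereRegular_geometry ((hsDiameter_le hσ.le N).trans_lt hσ2)
  rw [HardSphereFlow.collisionSum_eq]
  exact apply_vel_sub_eq_collisionSum (Φ.isTrajectory z hz) hG f i hab

/-- **The contamination bound along the hard-sphere flow on `𝕋³`** (flow form of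
`norm_collisionSum_nonret_le`, real-valued `f`). For `0 < σ < 1/2`, a flow `Φ` of `N + 1` spheres, a
good initial datum `z`, every `f : V3 → ℝ`, every `{0, 1}`-valued weight `ρ` on records (model: the
retained indicator `ret c = ω_fst(t_c) ω_snd(t_c)` of the pair-clamped streams of the line `birth`),
every particle `i` and window `(0, w]`, `0 ≤ w`: the sum of the NON-retained own increments
`Σ_{fst = i} (1 - ρ)(f v⁺ - f v⁻)` is bounded in absolute value by
`min 1 nret_i · (|f v_i(0)| + |f v_i(w)| + Σ_{fst = i} ρ (|f v⁻| + |f v⁺|))`,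
`nret_i = Σ_{fst = i} (1 - ρ)` the number of non-retained own records — with `f = Ψ ∘ ‖·‖` and
summed over `i` the right-hand side is the functional `Cont` of `stub_runCensus` (D₄). -/
theorem ccb5_nonret_contamination_le : ∀ (σ : ℝ), 0 < σ → σ < 2⁻¹ → ∀ (N : ℕ)
    (Φ : HardSphereFlow (Torus.geometry (Fin 3)) (hsDiameter σ N) (N + 1))
    (z : Config (N + 1) (Fin 3) T3), z ∈ Φ.good → ∀ (f : V3 → ℝ)
    (ρ : HardSphereCollisionRecord (Fin 3) T3 (N + 1) → ℝ), (∀ c, ρ c = 0 ∨ ρ c = 1) →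
    ∀ (i : Fin (N + 1)) (w : ℝ), 0 ≤ w →
    |Φ.collisionSum (Set.Ioc 0 w)
        (fun c => if c.fst = i then (1 - ρ c) * (f c.postVel.1 - f c.preVel.1) else 0) z| ≤
      min 1 (Φ.collisionSum (Set.Ioc 0 w) (fun c => if c.fst = i then 1 - ρ c else 0) z) *
        (|f (z i).2| + |f (Φ.flow w z i).2| +
          Φ.collisionSum (Set.Ioc 0 w)
            (fun c => if c.fst = i then ρ c * (|f c.preVel.1| + |f c.postVel.1|) else 0) z) := by
  intro σ hσ hσ2 N Φ z hz f ρ hρ i w hw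
  have hG : (Torus.geometry (Fin 3)).IsHardSphereRegular (hsDiameter σ N) :=
    Torus.isHardSphereRegular_geometry ((hsDiameter_le hσ.le N).trans_lt hσ2)
  have h := norm_collisionSum_nonret_le (Φ.isTrajectory z hz) hG f hρ i hw
  simp only [Real.norm_eq_abs, smul_eq_mul, Φ.flow_zero z hz] at h
  simpa only [HardSphereFlow.collisionSum_eq] using h

end Summit.AtomisticToContinuum.HydrodynamicLimit.Theorems.ClampedCorrectorBirth
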